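import Summits.AtomisticToContinuum.FouriersLaw.Theorems.EmbeddedDrudeMourreFGRGapBootstrapB
import Literature.Analysis.Calculus.SmoothKernelIntegral
import Mathlib.MeasureTheory.Function.JacobianOneDim
import Mathlib.MeasureTheory.Function.LocallyIntegrable

/-!
# FGRGap, line fold-jet-rigidity, stub S2 (averaging bootstrap) — file C:
# smoothness of `a ↦ ∫ χ (y) f (Φ (a, y)) dy` for locally integrable `f`

Support file for `stub_nullVectorRegularity` of crux `EmbeddedDrudeMourre.FGRGap`
(item stmt-AtomisticToContinuum-12595). The reusable core of the LS08 §5 averaging bootstrap: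
if `Φ` is smooth near `p₀` with `∂₂Φ (p₀) ≠ 0`, then for every smooth bump `χ` supported in a
small `y`-window and every locally integrable `f`, the average `a ↦ ∫ χ (y) f (Φ (a, y)) dy`
agrees on a small `a`-window with a globally smooth function (substitute `u = Φ (a, y)`
slice-wise with the kernel of file B, then differentiate under the integral sign against the
smooth compactly supported kernel).
-/

noncomputable section

open MeasureTheory Set Real Filter Topology Metric
open scoped ENNReal ContDiff
open Literature.MathematicalPhysics.KineticTheory.PhononBoltzmann
open Summit.AtomisticToContinuum.FouriersLaw.Theorems.FGRGap

namespace Summit.AtomisticToContinuum.FouriersLaw.Theorems.FGRGap.FoldJetRigidity.Bootstrap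

/-- Integrals of a real `L¹` function against a smooth real kernel evaluated along a bounded
map are smooth in the parameter (real-valued corollary of
`Literature.Analysis.Calculus.contDiff_integral_kernel_mul`). -/
theorem contDiff_integral_real_kernel_mul {Θ : ℝ × ℝ → ℝ} (hΘ : ContDiff ℝ ∞ Θ)
    {ν : Measure ℝ} {M : ℝ} (hM : ∀ᵐ y ∂ν, ‖y‖ ≤ M) {f : ℝ → ℝ} (hf : Integrable f ν) :
    ContDiff ℝ ∞ fun a : ℝ => ∫ y, Θ (a, y) * f y ∂ν := by
  have hA : ContDiff ℝ ∞ (fun q : ℝ × ℝ => (Θ q : ℂ)) := Complex.ofRealCLM.contDiff.comp hΘ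
  have hsm := Literature.Analysis.Calculus.contDiff_integral_kernel_mul (ν := ν)
    (A := fun q : ℝ × ℝ => (Θ q : ℂ)) hA aestronglyMeasurable_id hM hf.ofReal
  have heq : (fun a : ℝ => ∫ y, Θ (a, y) * f y ∂ν) =
      fun a : ℝ => (∫ y, (Θ (a, id y) : ℂ) * (f y : ℂ) ∂ν).re := by
    funext a
    have h1 : (∫ y, (Θ (a, id y) : ℂ) * (f y : ℂ) ∂ν) = ((∫ y, Θ (a, y) * f y ∂ν : ℝ) : ℂ) := by
      rw [← integral_complex_ofReal]
      congr 1
      funext y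
      push_cast
      rfl
    rw [h1, Complex.ofReal_re]
  rw [heq]
  exact Complex.reCLM.contDiff.comp hsm

/-- **Slice-wise substitution `u = Φ (a, y)`.** In the chart of file B, for `a` in the
half-window the average `∫ χ (y) f (Φ (a, y)) dy` equals `∫ Θ (a, u) f (u) du`, and the averaged
integrand is integrable. -/
theorem integral_comp_eq_integral_kernel {Φ : ℝ × ℝ → ℝ} {p₀ : ℝ × ℝ} {V : Set (ℝ × ℝ)}
    (hV : IsOpen V) (hΦ : ContDiffOn ℝ ∞ Φ V) {ε : ℝ} (hεV : closedBall p₀ ε ⊆ V)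
    (hinj : ∀ a ∈ Ioo (p₀.1 - ε) (p₀.1 + ε), InjOn (fun y => Φ (a, y)) (Ioo (p₀.2 - ε) (p₀.2 + ε)))
    {χ : ℝ → ℝ} (hχs : tsupport χ ⊆ Ioo (p₀.2 - ε) (p₀.2 + ε)) {Θ : ℝ × ℝ → ℝ}
    (hjac : ∀ a ∈ Ioo (p₀.1 - ε / 2) (p₀.1 + ε / 2), ∀ y ∈ Ioo (p₀.2 - ε) (p₀.2 + ε),
      Θ (a, Φ (a, y)) * |fderiv ℝ Φ (a, y) (0, 1)| = χ y)
    (himg : ∀ a ∈ Ioo (p₀.1 - ε / 2) (p₀.1 + ε / 2), ∀ u : ℝ, Θ (a, u) ≠ 0 →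
      u ∈ (fun y => Φ (a, y)) '' Ioo (p₀.2 - ε) (p₀.2 + ε))
    {f : ℝ → ℝ} (hF : ∀ a, Integrable (fun u => Θ (a, u) * f u))
    {a : ℝ} (ha : a ∈ Ioo (p₀.1 - ε / 2) (p₀.1 + ε / 2)) :
    Integrable (fun y => χ y * f (Φ (a, y))) ∧
      (∫ y, χ y * f (Φ (a, y))) = ∫ u, Θ (a, u) * f u := by
  set g : ℝ → ℝ := fun y => Φ (a, y) with hg
  set g' : ℝ → ℝ := fun y => fderiv ℝ Φ (a, y) (0, 1) with hg'
  set J : Set ℝ := Ioo (p₀.2 - ε) (p₀.2 + ε) with hJ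
  have haJ : ∀ y ∈ J, (a, y) ∈ ball p₀ ε := fun y hy => by
    rw [← ball_prod_same]
    refine ⟨?_, ?_⟩
    · show a ∈ ball p₀.1 ε
      rw [Real.ball_eq_Ioo]
      exact ⟨by linarith [ha.1, ha.2], by linarith [ha.1, ha.2]⟩
    · show y ∈ ball p₀.2 ε
      rw [Real.ball_eq_Ioo]
      exact hy
  have hderiv : ∀ y ∈ J, HasDerivWithinAt g (g' y) J y := by
    intro y hy
    have hV' : (a, y) ∈ V := hεV (ball_subset_closedBall (haJ y hy))
    have hd : HasFDerivAt Φ (fderiv ℝ Φ (a, y)) (a, y) :=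
      ((hΦ.contDiffAt (hV.mem_nhds hV')).differentiableAt (by simp)).hasFDerivAt
    have hl : HasDerivAt (fun y : ℝ => (a, y)) ((0 : ℝ), (1 : ℝ)) y :=
      (hasDerivAt_const y a).prodMk (hasDerivAt_id y)
    exact (hd.comp_hasDerivAt y hl).hasDerivWithinAt
  have hinj : InjOn g J := hinj a ⟨by linarith [ha.1, ha.2], by linarith [ha.1, ha.2]⟩
  have hχ0 : ∀ y ∉ J, χ y = 0 := fun y hy => image_eq_zero_of_notMem_tsupport fun h => hy (hχs h)
  have hptw : EqOn (fun y => |g' y| • (Θ (a, g y) * f (g y))) (fun y => χ y * f (Φ (a, y))) J := by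
    intro y hy
    simp only [hg, hg', smul_eq_mul]
    rw [← mul_assoc, mul_comm |fderiv ℝ Φ (a, y) (0, 1)|, hjac a ha y hy]
  have hcv := integral_image_eq_integral_abs_deriv_smul measurableSet_Ioo hderiv hinj
    (fun u => Θ (a, u) * f u)
  have hlhs : (∫ u in g '' J, Θ (a, u) * f u) = ∫ u, Θ (a, u) * f u := by
    apply setIntegral_eq_integral_of_forall_compl_eq_zero
    intro u hu
    have h0 : Θ (a, u) = 0 := by
      by_contra h
      exact hu (himg a ha u h)
    simp [h0]
  have hrhs : (∫ y in J, |g' y| • (Θ (a, g y) * f (g y))) = ∫ y, χ y * f (Φ (a, y)) := by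
    rw [setIntegral_congr_fun measurableSet_Ioo hptw]
    apply setIntegral_eq_integral_of_forall_compl_eq_zero
    intro y hy
    simp [hχ0 y hy]
  have hint1 : IntegrableOn (fun y => |g' y| • (Θ (a, g y) * f (g y))) J :=
    (integrableOn_image_iff_integrableOn_abs_deriv_smul measurableSet_Ioo hderiv hinj _).1
      (hF a).integrableOn
  have hint2 : IntegrableOn (fun y => χ y * f (Φ (a, y))) J :=
    hint1.congr_fun hptw measurableSet_Ioo
  refine ⟨hint2.integrable_of_forall_notMem_eq_zero fun y hy => by simp [hχ0 y hy], ?_⟩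
  rw [← hrhs, ← hcv, hlhs]

/-- **The core lemma of the averaging bootstrap** (the statement of helper stub C). Let
`Φ : ℝ² → ℝ` be smooth on an open `V ∋ p₀` with `∂₂Φ (p₀) ≠ 0`. Then there is `ε > 0` such that
for every smooth `χ` with compact support in `(p₀.2 - ε, p₀.2 + ε)` and every locally integrable
`f : ℝ → ℝ`, the function `a ↦ ∫ χ (y) f (Φ (a, y)) dy` has an integrable integrand and coincides
on `(p₀.1 - ε, p₀.1 + ε)` with a `C^∞` function on `ℝ`. -/
theorem exists_smooth_repr_integral_comp :
    ∀ (Φ : ℝ × ℝ → ℝ) (p₀ : ℝ × ℝ) (V : Set (ℝ × ℝ)), IsOpen V → p₀ ∈ V →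
      ContDiffOn ℝ ((⊤ : ℕ∞) : WithTop ℕ∞) Φ V → fderiv ℝ Φ p₀ (0, 1) ≠ 0 →
      ∃ ε : ℝ, 0 < ε ∧ ∀ χ : ℝ → ℝ, ContDiff ℝ ((⊤ : ℕ∞) : WithTop ℕ∞) χ →
        HasCompactSupport χ → tsupport χ ⊆ Set.Ioo (p₀.2 - ε) (p₀.2 + ε) →
        ∀ f : ℝ → ℝ, MeasureTheory.LocallyIntegrable f MeasureTheory.volume →
          (∀ a ∈ Set.Ioo (p₀.1 - ε) (p₀.1 + ε),
            MeasureTheory.Integrable (fun y => χ y * f (Φ (a, y))) MeasureTheory.volume) ∧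
          ∃ R : ℝ → ℝ, ContDiff ℝ ((⊤ : ℕ∞) : WithTop ℕ∞) R ∧
            ∀ a ∈ Set.Ioo (p₀.1 - ε) (p₀.1 + ε), R a = ∫ y, χ y * f (Φ (a, y)) := by
  intro Φ p₀ V hV hp₀ hΦ h2
  obtain ⟨ε, hε, hεV, hinj, hker⟩ := exists_chart_kernel Φ p₀ V hV hp₀ hΦ h2
  refine ⟨ε / 2, by positivity, fun χ hχ hχc hχs f hf => ?_⟩
  have hχs' : tsupport χ ⊆ Ioo (p₀.2 - ε) (p₀.2 + ε) :=
    hχs.trans (Ioo_subset_Ioo (by linarith) (by linarith))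
  obtain ⟨Θ, hΘs, hΘsupp, ⟨C, hC⟩, hjac, himg⟩ := hker χ hχ hχc hχs'
  -- the compact `u`-range and integrability of the kernel integrand
  set L : Set ℝ := Φ '' closedBall p₀ ε with hL
  have hLc : IsCompact L :=
    (isCompact_closedBall p₀ ε).image_of_continuousOn (hΦ.continuousOn.mono hεV)
  obtain ⟨M, hM⟩ := hLc.isBounded.subset_closedBall 0
  have hfL : IntegrableOn f L := hf.integrableOn_isCompact hLc
  have hΘ0 : ∀ a u, u ∉ L → Θ (a, u) = 0 := fun a u hu => by
    by_contra h
    exact hu (hΘsupp (a, u) h)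
  have hFL : ∀ a, IntegrableOn (fun u => Θ (a, u) * f u) L := fun a => by
    refine Integrable.bdd_mul (c := C) hfL ?_ (Eventually.of_forall fun u => ?_)
    · exact (hΘs.continuous.comp (Continuous.prodMk_right a)).aestronglyMeasurable
    · rw [Real.norm_eq_abs]; exact hC (a, u)
  have hF : ∀ a, Integrable (fun u => Θ (a, u) * f u) := fun a =>
    (hFL a).integrable_of_forall_notMem_eq_zero fun u hu => by simp [hΘ0 a u hu]
  have key := fun a (ha : a ∈ Ioo (p₀.1 - ε / 2) (p₀.1 + ε / 2)) =>
    integral_comp_eq_integral_kernel hV hΦ hεV hinj hχs' hjac himg hF ha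
  refine ⟨fun a ha => (key a ha).1, fun a => ∫ u in L, Θ (a, u) * f u, ?_, fun a ha => ?_⟩
  · refine contDiff_integral_real_kernel_mul hΘs (M := M) ?_ hfL
    rw [ae_restrict_iff' hLc.measurableSet]
    exact Eventually.of_forall fun u hu => mem_closedBall_zero_iff.1 (hM hu)
  · show (∫ u in L, Θ (a, u) * f u) = ∫ y, χ y * f (Φ (a, y))
    rw [(key a ha).2]
    exact setIntegral_eq_integral_of_forall_compl_eq_zero fun u hu => by simp [hΘ0 a u hu]

end Summit.AtomisticToContinuum.FouriersLaw.Theorems.FGRGap.FoldJetRigidity.Bootstrap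

namespace Summit.AtomisticToContinuum.FouriersLaw.Theorems.FGRGap.FoldJetRigidity

/-- **Helper stub C of `stub_nullVectorRegularity` (line fold-jet-rigidity): the core lemma of
the averaging bootstrap.** For `Φ : ℝ² → ℝ` smooth on an open `V ∋ p₀` with `∂₂Φ (p₀) ≠ 0`
there is `ε > 0` such that for every smooth `χ` compactly supported in `(p₀.2 - ε, p₀.2 + ε)` and
every locally integrable `f`, the average `a ↦ ∫ χ (y) f (Φ (a, y)) dy` has an integrable
integrand and agrees on `(p₀.1 - ε, p₀.1 + ε)` with a `C^∞` function on `ℝ` (slice-wise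
substitution `u = Φ (a, y)`, then differentiation under the integral sign against the smooth
compactly supported kernel). -/
theorem stub_nullVectorRegularity_partC :
    ∀ (Φ : ℝ × ℝ → ℝ) (p₀ : ℝ × ℝ) (V : Set (ℝ × ℝ)), IsOpen V → p₀ ∈ V → ContDiffOn ℝ ((⊤ : ℕ∞) : WithTop ℕ∞) Φ V → fderiv ℝ Φ p₀ (0, 1) ≠ 0 → ∃ ε : ℝ, 0 < ε ∧ ∀ χ : ℝ → ℝ, ContDiff ℝ ((⊤ : ℕ∞) : WithTop ℕ∞) χ → HasCompactSupport χ → tsupport χ ⊆ Set.Ioo (p₀.2 - ε) (p₀.2 + ε) → ∀ f : ℝ → ℝ, MeasureTheory.LocallyIntegrable f MeasureTheory.volume → (∀ a ∈ Set.Ioo (p₀.1 - ε) (p₀.1 + ε), MeasureTheory.Integrable (fun y => χ y * f (Φ (a, y))) MeasureTheory.volume) ∧ ∃ R : ℝ → ℝ, ContDiff ℝ ((⊤ : ℕ∞) : WithTop ℕ∞) R ∧ ∀ a ∈ Set.Ioo (p₀.1 - ε) (p₀.1 + ε), R a = ∫ y, χ y * f (Φ (a, y)) :=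
  Bootstrap.exists_smooth_repr_integral_comp

end Summit.AtomisticToContinuum.FouriersLaw.Theorems.FGRGap.FoldJetRigidity

end
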